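import Mathlib
import Literature.Analysis.Calculus.IteratedFDerivSymmetric
import Literature.Analysis.Calculus.FlatTaylorEstimate
import Literature.Analysis.Complex.DbarFrequencyUniqueContinuation
import HarnessLib

/-!
# Finite order of vanishing and holomorphic leading term for `‖∂̄h‖ ≤ M‖h‖` (vector-valued)

Let `F` be a complex inner-product space and `h : ℂ → F` smooth on a disc `B(0,R)` with
`h(0) = 0`, not identically zero, and

  `‖Dh(z)(1) + i Dh(z)(i)‖ ≤ M ‖h z‖`   on `B(0,R)`   (`2‖∂̄h‖ ≤ M‖h‖`).

This is the situation of a `J`-holomorphic curve `u` near a non-constant point in coordinates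
with `J(u(z₀)) = i` (`h = u - u(z₀)`, `∂ₛu + i∂ₜu = (i - J(u))∂ₜu`, `‖J(u) - i‖ ≤ C‖u - u(z₀)‖`),
and of differences of branches. We prove (`exists_leadingTerm`, `exists_leadingTerm_bounds`):

  there are `k ≥ 1` and `a ∈ F ∖ {0}` with `h(z) = z^k • a + R(z)`, where `R` is smooth and
  vanishes to order `k` at `0`; in particular `‖R(z)‖ ≤ C‖z‖^{k+1}`, `‖DR(z)‖ ≤ C‖z‖^k` near `0`,

i.e. the Taylor series of `h` at `0` is nontrivial and its lowest term is the HOLOMORPHIC monomial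
`z^k • a` — the smooth case of Wendl 2020, Cor. B.21 / Rem. B.22 (there via the similarity
principle; McDuff–Salamon 2012 §2.3), which is the first step (the "tangent space and critical
order") of the local representation formula for `J`-holomorphic curves (Wendl 2020 Thm B.23;
Micallef–White 1995). Ingredients:

* finite order: the strong unique continuation theorem for the inequality, proved by the
  frequency function in `Literature/Analysis/Complex/DbarFrequencyUniqueContinuation.lean`
  (`eq_zero_of_flat`), and "flat ⇒ small" (`Literature/Analysis/Calculus/FlatTaylorEstimate.lean`);
* holomorphy of the lowest term: with `ψ = D^k h(0)` (first nonzero derivative) the defect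
  `e = Dh(1) + iDh(i)` is `O(‖z‖^k)` and its jets are `D^j e(0)(m) = D^{j+1}h(0)(m,1) + i D^{j+1}h(0)(m,i)`
  (`iteratedFDeriv_dbarDefect_apply`), so "small ⇒ flat" (`iteratedFDeriv_eq_zero_of_norm_le_pow`)
  gives `D^{k-1}e(0) = 0`: `ψ` is complex-linear in the last slot; symmetry of `ψ`
  (`Literature/Analysis/Calculus/IteratedFDerivSymmetric.lean`) spreads this to all slots
  (`forall_update_I_of_symmetric`), and a real-multilinear map on `ℂ^k` complex-linear in each
  slot is `v ↦ (∏ vᵢ) • ψ(1,…,1)` (`apply_eq_prod_smul_of_update_I`).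

Everything is proved; no named facts.

## References

* C. Wendl, *Lectures on Contact 3-Manifolds, Holomorphic Curves and Intersection Theory*,
  Cambridge Tracts in Math. 220 (2020), App. B: Thm B.20, Cor. B.21, Rem. B.22, Thm B.23,
  Lemma B.29. [Wendl2020]
* D. McDuff, D. Salamon, *J-holomorphic curves and symplectic topology*, 2nd ed. (2012), §2.3.
  [McDuffSalamon2012]
* M. Micallef, B. White, *The structure of branch points in minimal surfaces and in
  pseudoholomorphic curves*, Ann. of Math. 141 (1995). [MicallefWhite1995]
* T. Carleman, Ark. Mat. Astr. Fys. 26B (1939), no. 17. [Carleman1939Unicite]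
-/

noncomputable section

open scoped ContDiff Topology Nat
open Set Filter Metric Function

namespace Literature.Analysis.Complex

open Literature.Analysis.Calculus _root_.Complex

section Algebra

variable {F : Type*} [NormedAddCommGroup F] [NormedSpace ℂ F]

/-- Complex-linearity in a slot, scalar form: from `ψ(…, i, …) = i • ψ(…, 1, …)` and real
linearity, `ψ(…, y, …) = y • ψ(…, 1, …)` for every `y ∈ ℂ`. [folklore] -/
theorem apply_update_eq_smul {k : ℕ} (ψ : ContinuousMultilinearMap ℝ (fun _ : Fin k => ℂ) F)
    (hI : ∀ (m : Fin k → ℂ) (i : Fin k), ψ (update m i I) = I • ψ (update m i 1))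
    (m : Fin k → ℂ) (i : Fin k) (y : ℂ) : ψ (update m i y) = y • ψ (update m i 1) := by
  have hy : y = y.re • (1 : ℂ) + y.im • I := by apply Complex.ext <;> simp
  conv_lhs => rw [hy]
  rw [ψ.map_update_add, ψ.map_update_smul, ψ.map_update_smul, hI m i, ← Complex.coe_smul,
    ← Complex.coe_smul, smul_smul, ← add_smul]
  congr 1
  apply Complex.ext <;> simp

/-- **A real-multilinear map on `ℂ^k` which is complex-linear in each slot is determined by
`ψ(1,…,1)`:** `ψ(c₁,…,c_k) = (∏ cᵢ) • ψ(1,…,1)`. [folklore] -/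
theorem apply_eq_prod_smul_of_update_I {k : ℕ} (ψ : ContinuousMultilinearMap ℝ (fun _ : Fin k => ℂ) F)
    (hI : ∀ (m : Fin k → ℂ) (i : Fin k), ψ (update m i I) = I • ψ (update m i 1))
    (c : Fin k → ℂ) : ψ c = (∏ i, c i) • ψ (fun _ => 1) := by
  have key := apply_update_eq_smul ψ hI
  have hind : ∀ s : Finset (Fin k),
      ψ c = (∏ i ∈ s, c i) • ψ (fun i => if i ∈ s then 1 else c i) := by
    intro s
    induction s using Finset.induction_on with
    | empty => simp
    | insert j s hj IH =>
      set g : Fin k → ℂ := fun i => if i ∈ s then 1 else c i with hg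
      have hgj : g j = c j := by simp [hg, hj]
      have h1 : ψ g = c j • ψ (update g j 1) := by
        conv_lhs => rw [← update_eq_self j g, hgj]
        exact key g j (c j)
      have h2 : update g j 1 = fun i => if i ∈ insert j s then 1 else c i := by
        funext i
        by_cases hij : i = j
        · subst hij; simp
        · rw [update_of_ne hij]; simp [hg, hij]
      rw [IH, h1, h2, smul_smul, Finset.prod_insert hj, mul_comm]
  simpa using hind Finset.univ

/-- Diagonal form: `ψ(z,…,z) = z^k • ψ(1,…,1)`. [folklore] -/
theorem apply_const_eq_pow_smul_of_update_I {k : ℕ}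
    (ψ : ContinuousMultilinearMap ℝ (fun _ : Fin k => ℂ) F)
    (hI : ∀ (m : Fin k → ℂ) (i : Fin k), ψ (update m i I) = I • ψ (update m i 1))
    (z : ℂ) : ψ (fun _ => z) = z ^ k • ψ (fun _ => 1) := by
  rw [apply_eq_prod_smul_of_update_I ψ hI, Finset.prod_const, Finset.card_univ, Fintype.card_fin]

/-- **Symmetry spreads complex-linearity from the last slot to all slots.** [folklore] -/
theorem forall_update_I_of_symmetric {k : ℕ}
    (ψ : ContinuousMultilinearMap ℝ (fun _ : Fin (k + 1) => ℂ) F)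
    (hsym : ∀ (v : Fin (k + 1) → ℂ) (σ : Equiv.Perm (Fin (k + 1))), ψ (v ∘ σ) = ψ v)
    (hlast : ∀ m : Fin k → ℂ, ψ (Fin.snoc m I) = I • ψ (Fin.snoc m 1))
    (m : Fin (k + 1) → ℂ) (i : Fin (k + 1)) : ψ (update m i I) = I • ψ (update m i 1) := by
  set σ : Equiv.Perm (Fin (k + 1)) := Equiv.swap i (Fin.last k) with hσ
  have hmove : ∀ x : ℂ, ψ (update m i x) = ψ (Fin.snoc (Fin.init (m ∘ σ)) x) := by
    intro x
    rw [← hsym (update m i x) σ, update_comp_equiv]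
    have hσi : σ.symm i = Fin.last k := by rw [hσ, Equiv.symm_swap, Equiv.swap_apply_left]
    rw [hσi]
    conv_lhs => rw [← Fin.snoc_init_self (m ∘ σ)]
    rw [Fin.update_snoc_last]
  rw [hmove I, hmove 1, hlast]

end Algebra

section Jet

variable {F : Type*} [NormedAddCommGroup F] [NormedSpace ℂ F]

/-- **Jets of the `∂̄`-defect.** For `e(y) = Dh(y)1 + i Dh(y)i` and `h` of class `C^{j+1}` at
`0`: `D^j e(0)(m) = D^{j+1}h(0)(m, 1) + i • D^{j+1}h(0)(m, i)` (the new direction enters the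
LAST slot, Mathlib's `iteratedFDeriv_succ_apply_right`). [folklore] -/
theorem iteratedFDeriv_dbarDefect_apply {h : ℂ → F} {j : ℕ} {n : WithTop ℕ∞}
    (hh : ContDiffAt ℝ n h 0) (hj : ((j + 1 : ℕ) : WithTop ℕ∞) ≤ n) (m : Fin j → ℂ) :
    iteratedFDeriv ℝ j (fun y => fderiv ℝ h y 1 + I • fderiv ℝ h y I) 0 m =
      iteratedFDeriv ℝ (j + 1) h 0 (Fin.snoc m 1) + I • iteratedFDeriv ℝ (j + 1) h 0 (Fin.snoc m I) := by
  have hd : ContDiffAt ℝ j (fderiv ℝ h) 0 := hh.fderiv_right (by exact_mod_cast hj)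
  have hv : ∀ v : ℂ, ContDiffAt ℝ j (fun y => fderiv ℝ h y v) 0 := fun v =>
    hd.clm_apply contDiffAt_const
  have happly : ∀ v : ℂ, iteratedFDeriv ℝ j (fun y => fderiv ℝ h y v) 0 m =
      iteratedFDeriv ℝ (j + 1) h 0 (Fin.snoc m v) := by
    intro v
    have h1 : (fun y => fderiv ℝ h y v) = (ContinuousLinearMap.apply ℝ F v) ∘ fderiv ℝ h := by
      funext y; simp
    rw [h1, (ContinuousLinearMap.apply ℝ F v).iteratedFDeriv_comp_left hd le_rfl,
      ContinuousLinearMap.compContinuousMultilinearMap_coe, comp_apply,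
      ContinuousLinearMap.apply_apply, iteratedFDeriv_succ_apply_right]
    simp [Fin.init_snoc, Fin.snoc_last]
  have hsum : (fun y => fderiv ℝ h y 1 + I • fderiv ℝ h y I) =
      (fun y => fderiv ℝ h y 1) + fun y => I • fderiv ℝ h y I := rfl
  rw [hsum, iteratedFDeriv_add_apply (hv 1) ((hv I).const_smul I),
    iteratedFDeriv_const_smul_apply' (hv I)]
  simp only [add_apply, smul_apply, happly]

end Jet

section LeadingTerm

open DbarFrequency Metric Set Filter

variable {F : Type*} [NormedAddCommGroup F] [InnerProductSpace ℂ F]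

/-- **Finite order of vanishing and holomorphic leading Taylor term for `‖∂̄h‖ ≤ M‖h‖`**
(vector-valued, smooth case of Wendl 2020 Cor. B.21 / Rem. B.22: "the Taylor series of `η` about
`z₀` is nontrivial and its lowest-order term is holomorphic"). Let `h` be `C^∞` on `B(0,R)` with
values in a complex inner-product space, `h(0) = 0`, `h ≢ 0` on `B(0,R)`, and
`‖Dh(z)1 + i Dh(z)i‖ ≤ M‖h z‖` on `B(0,R)`. Then there are `k ≥ 1` and `a ∈ F ∖ {0}` with
`D^j h(0) = 0` for `j < k`, `D^k h(0)(v₁,…,v_k) = k! (∏ vᵢ) • a` (so the degree-`k` Taylor term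
is `z ↦ z^k • a`), and `h - z^k • a` vanishes to order `k` at `0` (all derivatives of order `≤ k`
vanish). Proof: strong unique continuation (`eq_zero_of_flat`) gives a first nonzero derivative
`ψ = D^k h(0)`; flatness makes `‖h‖ ≤ C‖z‖^k`, so the defect `e = Dh(1) + iDh(i)` is
`O(‖z‖^k)` with `D^j e(0) = 0` (`j < k-1`), whence `D^{k-1}e(0) = 0`
(`iteratedFDeriv_eq_zero_of_norm_le_pow`), i.e. `ψ` is complex-linear in its last slot; by the
symmetry of `ψ` in every slot, so `ψ(v) = (∏ vᵢ) • ψ(1,…,1)`.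
[cite: Wendl2020, App. B, Cor. B.21 and Rem. B.22; Carleman1939Unicite, Théorème 1] -/
theorem exists_leadingTerm {h : ℂ → F} {R M : ℝ} (hR : 0 < R)
    (hh : ContDiffOn ℝ ∞ h (ball (0 : ℂ) R))
    (hM : ∀ z ∈ ball (0 : ℂ) R, ‖fderiv ℝ h z 1 + I • fderiv ℝ h z I‖ ≤ M * ‖h z‖)
    (h0 : h 0 = 0) (hne : ∃ z ∈ ball (0 : ℂ) R, h z ≠ 0) :
    ∃ (k : ℕ) (a : F), 0 < k ∧ a ≠ 0 ∧
      (∀ j < k, iteratedFDeriv ℝ j h 0 = 0) ∧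
      (∀ v : Fin k → ℂ, iteratedFDeriv ℝ k h 0 v = ((k ! : ℂ) * ∏ i, v i) • a) ∧
      (∀ j ≤ k, iteratedFDeriv ℝ j (fun z => h z - z ^ k • a) 0 = 0) := by
  have hinf : ∀ j : ℕ, ((j : ℕ) : WithTop ℕ∞) ≤ ∞ := fun j => by exact_mod_cast le_top
  have hh0 : ContDiffAt ℝ ∞ h 0 := hh.contDiffAt (ball_mem_nhds 0 hR)
  -- hypotheses of Part II on the punctured disc
  have hh2 : ContDiffOn ℝ 2 h (ball (0 : ℂ) R \ {0}) :=
    (hh.of_le (by norm_cast)).mono fun z hz => hz.1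
  have hM2 : ∀ z ∈ ball (0 : ℂ) R \ {0}, ‖fderiv ℝ h z 1 + I • fderiv ℝ h z I‖ ≤ M * ‖h z‖ :=
    fun z hz => hM z hz.1
  -- Step 1: some derivative at `0` is nonzero (strong unique continuation)
  have hex : ∃ j : ℕ, iteratedFDeriv ℝ j h 0 ≠ 0 := by
    by_contra hall
    push Not at hall
    have hflat : ∀ m : ℕ, ∃ C ρ : ℝ, 0 < ρ ∧ ∀ z ∈ ball (0 : ℂ) ρ \ {0}, ‖h z‖ ≤ C * ‖z‖ ^ m := by
      intro m
      obtain ⟨C, ρ, -, hρ, -, hb⟩ :=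
        norm_le_of_iteratedFDeriv_eq_zero hh (hinf m) hR fun j _ => hall j
      exact ⟨C, ρ, hρ, fun z hz => hb z hz.1⟩
    have hzero := eq_zero_of_flat hh2 hM2 hflat
    obtain ⟨z, hz, hzne⟩ := hne
    by_cases hz0 : z = 0
    · exact hzne (by rw [hz0, h0])
    · exact hzne (hzero z ⟨hz, hz0⟩)
  classical
  -- Step 2: the order `k = k' + 1`
  obtain ⟨k, hk, hlow⟩ : ∃ k, iteratedFDeriv ℝ k h 0 ≠ 0 ∧ ∀ j < k, iteratedFDeriv ℝ j h 0 = 0 :=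
    ⟨Nat.find hex, Nat.find_spec hex, fun j hj => by simpa using Nat.find_min hex hj⟩
  have hk0 : k ≠ 0 := by
    rintro rfl
    apply hk
    ext v
    simp [h0]
  obtain ⟨k', rfl⟩ : ∃ k', k = k' + 1 := Nat.exists_eq_succ_of_ne_zero hk0
  set ψ := iteratedFDeriv ℝ (k' + 1) h 0 with hψ
  -- Step 3: flat to order `k` ⇒ `‖h‖ ≤ C₁ ‖z‖^k`, hence `‖e‖ ≤ (max M 0) C₁ ‖z‖^k`
  obtain ⟨C₁, ρ₁, hC₁, hρ₁, hρ₁R, hb₁⟩ :=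
    norm_le_of_iteratedFDeriv_eq_zero hh (hinf (k' + 1)) hR hlow
  set e : ℂ → F := fun y => fderiv ℝ h y 1 + I • fderiv ℝ h y I with he_def
  have hd : ContDiffOn ℝ ∞ (fderiv ℝ h) (ball (0 : ℂ) R) :=
    hh.fderiv_of_isOpen isOpen_ball (by simp)
  have he : ContDiffOn ℝ ∞ e (ball (0 : ℂ) ρ₁) := by
    have h1 : ContDiffOn ℝ ∞ (fun y => fderiv ℝ h y 1) (ball (0 : ℂ) R) :=
      hd.clm_apply contDiffOn_const
    have h2 : ContDiffOn ℝ ∞ (fun y => fderiv ℝ h y I) (ball (0 : ℂ) R) :=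
      hd.clm_apply contDiffOn_const
    exact (h1.add (h2.const_smul I)).mono (ball_subset_ball hρ₁R)
  have hesmall : ∀ z ∈ ball (0 : ℂ) ρ₁, ‖e z‖ ≤ max M 0 * C₁ * ‖z‖ ^ (k' + 1) := by
    intro z hz
    calc ‖e z‖ ≤ M * ‖h z‖ := hM z (ball_subset_ball hρ₁R hz)
      _ ≤ max M 0 * ‖h z‖ := mul_le_mul_of_nonneg_right (le_max_left _ _) (norm_nonneg _)
      _ ≤ max M 0 * (C₁ * ‖z‖ ^ (k' + 1)) :=
          mul_le_mul_of_nonneg_left (hb₁ z hz) (le_max_right _ _)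
      _ = max M 0 * C₁ * ‖z‖ ^ (k' + 1) := by ring
  have helow : ∀ j < k', iteratedFDeriv ℝ j e 0 = 0 := by
    intro j hj
    ext m
    rw [he_def, iteratedFDeriv_dbarDefect_apply hh0 (hinf _) m,
      hlow (j + 1) (by omega)]
    simp
  have hetop : iteratedFDeriv ℝ k' e 0 = 0 :=
    iteratedFDeriv_eq_zero_of_norm_le_pow he (hinf _) hρ₁ helow hesmall
  -- Step 4: complex-linearity of `ψ` in the last slot, then in all slots
  have hlast : ∀ m : Fin k' → ℂ, ψ (Fin.snoc m I) = I • ψ (Fin.snoc m 1) := by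
    intro m
    have h1 := congrArg (fun T : ContinuousMultilinearMap ℝ (fun _ : Fin k' => ℂ) F => T m) hetop
    simp only [zero_apply] at h1
    rw [he_def, iteratedFDeriv_dbarDefect_apply hh0 (hinf _) m] at h1
    -- `A + I • B = 0` ⇒ `B = I • A`
    have hA : ψ (Fin.snoc m 1) = -(I • ψ (Fin.snoc m I)) := eq_neg_of_add_eq_zero_left h1
    rw [hA, smul_neg, smul_smul, I_mul_I, neg_smul, one_smul, neg_neg]
  have hsym : ∀ (v : Fin (k' + 1) → ℂ) (σ : Equiv.Perm (Fin (k' + 1))), ψ (v ∘ σ) = ψ v :=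
    fun v σ => iteratedFDeriv_comp_perm_of_le hh0 (hinf _) v σ
  have hall : ∀ (m : Fin (k' + 1) → ℂ) (i : Fin (k' + 1)), ψ (update m i I) = I • ψ (update m i 1) :=
    forall_update_I_of_symmetric ψ hsym hlast
  have hprod : ∀ v : Fin (k' + 1) → ℂ, ψ v = (∏ i, v i) • ψ (fun _ => 1) :=
    apply_eq_prod_smul_of_update_I ψ hall
  -- Step 5: the coefficient `a = ψ(1,…,1) / k!`
  set a : F := (((k' + 1) ! : ℕ) : ℝ)⁻¹ • ψ (fun _ => 1) with ha_def
  have hfact : (((k' + 1) ! : ℕ) : ℝ) ≠ 0 := by exact_mod_cast Nat.factorial_ne_zero _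
  have hψ1 : ψ (fun _ => 1) = (((k' + 1) ! : ℕ) : ℝ) • a := by
    rw [ha_def, smul_smul, mul_inv_cancel₀ hfact, one_smul]
  have ha0 : a ≠ 0 := by
    intro ha0
    apply hk
    ext v
    rw [hprod v, hψ1, ha0, smul_zero, smul_zero, zero_apply]
  -- Step 6: `z^k • a` is the diagonal polynomial of `ψ / k!`
  have hPQ : (fun z : ℂ => z ^ (k' + 1) • a) =
      fun z : ℂ => (((k' + 1) ! : ℕ) : ℝ)⁻¹ • ψ (fun _ => z) := by
    funext z
    rw [apply_const_eq_pow_smul_of_update_I ψ hall z, hψ1, smul_comm (z ^ (k' + 1)) _ a,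
      smul_smul (((k' + 1) ! : ℕ) : ℝ)⁻¹, inv_mul_cancel₀ hfact, one_smul]
  have hdiag : ContDiff ℝ ∞ fun z : ℂ => ψ fun _ => z := contDiff_diagonal ψ
  have hP : ContDiff ℝ ∞ fun z : ℂ => z ^ (k' + 1) • a := by
    rw [hPQ]; exact contDiff_const.smul hdiag
  refine ⟨k' + 1, a, Nat.succ_pos _, ha0, hlow, fun v => ?_, fun j hj => ?_⟩
  · -- the formula for `D^k h(0)`
    rw [← hψ, hprod v, hψ1, ← Complex.coe_smul, smul_smul, mul_comm]
    push_cast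
    rfl
  · -- flatness of the remainder to order `k`
    have hsub : iteratedFDeriv ℝ j (fun z => h z - z ^ (k' + 1) • a) 0 =
        iteratedFDeriv ℝ j h 0 - iteratedFDeriv ℝ j (fun z : ℂ => z ^ (k' + 1) • a) 0 := by
      rw [show (fun z => h z - z ^ (k' + 1) • a) = h - fun z : ℂ => z ^ (k' + 1) • a from rfl]
      exact iteratedFDeriv_sub_apply (hh0.of_le (hinf j)) (hP.contDiffAt.of_le (hinf j))
    rw [hsub, hPQ, iteratedFDeriv_const_smul_apply' (hdiag.contDiffAt.of_le (hinf j))]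
    rcases hj.lt_or_eq with hj' | rfl
    · rw [hlow j hj', iteratedFDeriv_diagonal_eq_zero ψ hj'.ne, smul_zero, sub_zero]
    · rw [hψ, iteratedFDeriv_diag_iteratedFDeriv hh0 (hinf _) (0 : ℂ), ← hψ, smul_smul,
        inv_mul_cancel₀ hfact, one_smul, sub_self]

/-- **Leading term with remainder bounds** (the form used for the `k`-th root chart of the local
representation formula, Wendl 2020 §B.2.3): under the hypotheses of `exists_leadingTerm`,
`‖h(z) - z^k • a‖ ≤ C‖z‖^{k+1}` and `‖D(h - z^k • a)(z)‖ ≤ C‖z‖^k` on a ball `B(0,ρ)`.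
[cite: Wendl2020, App. B, Cor. B.21, Rem. B.22 and Lemma B.29] -/
theorem exists_leadingTerm_bounds {h : ℂ → F} {R M : ℝ} (hR : 0 < R)
    (hh : ContDiffOn ℝ ∞ h (ball (0 : ℂ) R))
    (hM : ∀ z ∈ ball (0 : ℂ) R, ‖fderiv ℝ h z 1 + I • fderiv ℝ h z I‖ ≤ M * ‖h z‖)
    (h0 : h 0 = 0) (hne : ∃ z ∈ ball (0 : ℂ) R, h z ≠ 0) :
    ∃ (k : ℕ) (a : F) (C ρ : ℝ), 0 < k ∧ a ≠ 0 ∧ 0 < ρ ∧ ρ ≤ R ∧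
      (∀ z ∈ ball (0 : ℂ) ρ, ‖h z - z ^ k • a‖ ≤ C * ‖z‖ ^ (k + 1)) ∧
      (∀ z ∈ ball (0 : ℂ) ρ, ‖fderiv ℝ (fun z => h z - z ^ k • a) z‖ ≤ C * ‖z‖ ^ k) := by
  have hinf : ∀ j : ℕ, ((j : ℕ) : WithTop ℕ∞) ≤ ∞ := fun j => by exact_mod_cast le_top
  obtain ⟨k, a, hk, ha, -, -, hflat⟩ := exists_leadingTerm hR hh hM h0 hne
  have hP : ContDiff ℝ ∞ fun z : ℂ => z ^ k • a := (contDiff_id.pow k).smul contDiff_const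
  have hRm : ContDiffOn ℝ ∞ (fun z => h z - z ^ k • a) (ball (0 : ℂ) R) := hh.sub hP.contDiffOn
  obtain ⟨C, ρ, -, hρ, hρR, hb⟩ := norm_le_of_iteratedFDeriv_eq_zero hRm (hinf (k + 1)) hR
    fun j hj => hflat j (Nat.lt_succ_iff.mp hj)
  have hg : ContDiffOn ℝ ∞ (fderiv ℝ fun z => h z - z ^ k • a) (ball (0 : ℂ) R) :=
    hRm.fderiv_of_isOpen isOpen_ball (by simp)
  have hgflat : ∀ j < k, iteratedFDeriv ℝ j (fderiv ℝ fun z => h z - z ^ k • a) 0 = 0 := by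
    intro j hj
    apply norm_eq_zero.mp
    rw [norm_iteratedFDeriv_fderiv, hflat (j + 1) (by omega), norm_zero]
  obtain ⟨C', ρ', -, hρ', -, hb'⟩ := norm_le_of_iteratedFDeriv_eq_zero hg (hinf k) hR hgflat
  refine ⟨k, a, max C C', min ρ ρ', hk, ha, lt_min hρ hρ', (min_le_left _ _).trans hρR,
    fun z hz => ?_, fun z hz => ?_⟩
  · have hz' : z ∈ ball (0 : ℂ) ρ := ball_subset_ball (min_le_left _ _) hz
    exact (hb z hz').trans (mul_le_mul_of_nonneg_right (le_max_left _ _) (by positivity))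
  · have hz' : z ∈ ball (0 : ℂ) ρ' := ball_subset_ball (min_le_right _ _) hz
    exact (hb' z hz').trans (mul_le_mul_of_nonneg_right (le_max_right _ _) (by positivity))

end LeadingTerm

end Literature.Analysis.Complex

end
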